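import Summits.Ventures.HSemireg.WedgeHankelSubstitutionKernelFlag
import Summits.Ventures.HSemireg.WedgeHankelSubstitutionJordanPartitionParabolic
import Summits.Ventures.HSemireg.WedgeHankelSubstitutionSwapEigenspaces

/-!
# Venture HSemireg — THE KERNEL FLAG OF THE LOWER SHEAR IS THE OSCULATING FLAG OF THE PURE CLASS: `ker (SbC(1 0 c 1) − 1)^k = span{E_0, …, E_{k−1}}` and
# `range (SbC(1 0 c 1) − 1)^k = span{E_0, …, E_{n−k}}` when `n!·c ≠ 0` — the swap-conjugate of the upper shear's flags (K6), read through `E_p ↦ E_{n−p}` (K14)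

HONEST FRAMING. Part of the Lean index of the computation cell `pub-hsemireg` (seat p10 gen 21, Sunday typer «UNIFORM-IN-n»).
Finite-dimensional EXTERIOR ALGEBRA + linear algebra ONLY: no variety, no cohomology theory, no sheaf, no Ext group, no semiregularity map;
nothing here says that HC / HC_CM / HC_AV holds; no Literature fact is declared or used.  Custodian versions as in `WedgeHankelSiegelIdeal` (1/3) and `WedgeHankelFrameChange`;
the dictionary (the lower shear `y ↦ y + c x` fixes the pure class `x^n` and moves the point class; its invariant flag is the order-of-vanishing flag at `0`) is QUOTED, never
asserted.

WHAT IS IN THE TREE.  K6 (`WedgeHankelSubstitutionKernelFlag`): `ker (SbC(1 λ 0 1) − 1)^k = span{E_i : n < i + k}`, `range = span{E_a : k ≤ a}` for `n!·λ ≠ 0`; K5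
(`WedgeHankelSubstitutionJordanPartitionParabolic`): `pow_mul_eq_mul_pow_of_mul_eq`; K14 (`WedgeHankelSubstitutionSwapEigenspaces`): `SbC_swap_spikeBasis` (`E_p ↦ E_{rev p}`); J11:
`SbC_lower_shear_eq_swap_conj`, `SbC_swap_mul_swap`, `ker_eq_map_of_conj`.  THIS FILE (namespace `Summit.Ventures.HSemireg.Wedge.HankelFrameChange` continued; imports K6, K5,
K14):
* §300 `lower_shear_sub_one_mul_swap` (`(L − 1)·S = S·(U − 1)`), `ker_pow_lower_shear_eq_map` / `range_pow_lower_shear_eq_map` (every field: `ker (L−1)^k = S(ker (U−1)^k)`,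
  `range (L−1)^k = S(range (U−1)^k)`), `map_swap_span_spikeBasis` (`S(span{E_i : P i}) = span{E_i : P (rev i)}`), and for `n!·c ≠ 0`:
  **`ker_SbC_lower_shear_sub_one_pow_eq_span`: `ker (SbC(1 0 c 1) − 1)^k = span{E_j : j < k}`**, **`range_SbC_lower_shear_sub_one_pow_eq_span`: `range (SbC(1 0 c 1) − 1)^k =
  span{E_j : j + k ≤ n}`**, `…_charZero` ×2 — the pure class `E_0` spans `ker(L − 1)` and the bottom spikes its osculating flag.
NOT typed here: characteristic `p ≤ n` (K1/K5 give the dimensions only); anything Ext-side.  New names only.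
-/

open Module

namespace Summit.Ventures.HSemireg.Wedge.HankelFrameChange

open Summit.Ventures.HSemireg.Wedge Summit.Ventures.HSemireg.Wedge.Kunneth Summit.Ventures.HSemireg.Wedge.Hankel
  Summit.Ventures.HSemireg.Wedge.BasisFree Summit.Ventures.HSemireg.Wedge.HankelSiegel Summit.Ventures.HSemireg.Wedge.HankelSiegelIdeal
  Summit.Ventures.HSemireg.Wedge.KunnethKernel Summit.Ventures.HSemireg.Wedge.HankelRankOne Summit.Ventures.HSemireg.Wedge.KernelDuality

variable (K : Type*) [Field K] {n : ℕ}

/-! ## §300. The lower shear's kernel and image flags -/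

/-- `(SbC(1 0 c 1) − 1)·S = S·(SbC(1 c 0 1) − 1)` with `S = SbC(0 1 1 0)` (J11: `L = S U S`, `S² = 1`). -/
theorem lower_shear_sub_one_mul_swap (c : K) :
    (SbC K 1 0 c 1 (n := n) - 1) * SbC K 0 1 1 0 = SbC K 0 1 1 0 * (SbC K 1 c 0 1 - 1) := by
  have hSS : ∀ g : spikeSpan K n, SbC K 0 1 1 0 (SbC K 0 1 1 0 g) = g := fun g => by
    rw [← Module.End.mul_apply, SbC_swap_mul_swap, Module.End.one_apply]
  refine LinearMap.ext fun f => ?_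
  simp only [Module.End.mul_apply, LinearMap.sub_apply, Module.End.one_apply, map_sub, SbC_lower_shear_eq_swap_conj K c, hSS]

/-- every field: `ker (SbC(1 0 c 1) − 1)^k = S (ker (SbC(1 c 0 1) − 1)^k)`. -/
theorem ker_pow_lower_shear_eq_map (c : K) (k : ℕ) :
    LinearMap.ker ((SbC K 1 0 c 1 (n := n) - 1) ^ k) = (LinearMap.ker ((SbC K 1 c 0 1 (n := n) - 1) ^ k)).map (SbC K 0 1 1 0) :=
  ker_eq_map_of_conj K (pow_mul_eq_mul_pow_of_mul_eq K (lower_shear_sub_one_mul_swap K c) k) (SbC_swap_mul_swap K) (SbC_swap_mul_swap K)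

/-- every field: `range (SbC(1 0 c 1) − 1)^k = S (range (SbC(1 c 0 1) − 1)^k)`. -/
theorem range_pow_lower_shear_eq_map (c : K) (k : ℕ) :
    LinearMap.range ((SbC K 1 0 c 1 (n := n) - 1) ^ k) = (LinearMap.range ((SbC K 1 c 0 1 (n := n) - 1) ^ k)).map (SbC K 0 1 1 0) := by
  have h := pow_mul_eq_mul_pow_of_mul_eq K (lower_shear_sub_one_mul_swap K c (n := n)) k
  -- `A^k = S B^k S`
  have e : (SbC K 1 0 c 1 (n := n) - 1) ^ k = SbC K 0 1 1 0 * (SbC K 1 c 0 1 - 1) ^ k * SbC K 0 1 1 0 := by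
    rw [← h, mul_assoc, SbC_swap_mul_swap, mul_one]
  have hS : LinearMap.range (SbC K 0 1 1 0 (n := n)) = ⊤ :=
    LinearMap.range_eq_top.mpr fun g => ⟨SbC K 0 1 1 0 g, by rw [← Module.End.mul_apply, SbC_swap_mul_swap, Module.End.one_apply]⟩
  rw [e, Module.End.mul_eq_comp, LinearMap.range_comp, hS, Submodule.map_top, Module.End.mul_eq_comp, LinearMap.range_comp]

/-- the swap maps a span of spikes to the span of the reversed spikes: `S(span{E_i : P i}) = span{E_j : P (rev j)}`. -/
theorem map_swap_span_spikeBasis (P : Fin (n + 1) → Prop) :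
    (Submodule.span K (Set.range fun i : {i : Fin (n + 1) // P i} => spikeBasis K n i)).map (SbC K 0 1 1 0) =
      Submodule.span K (Set.range fun j : {j : Fin (n + 1) // P (Fin.rev j)} => spikeBasis K n j) := by
  have hset : ⇑(SbC K 0 1 1 0 (n := n)) '' (Set.range fun i : {i : Fin (n + 1) // P i} => spikeBasis K n i) =
      Set.range fun j : {j : Fin (n + 1) // P (Fin.rev j)} => spikeBasis K n j := by
    ext x
    constructor
    · rintro ⟨_, ⟨⟨i, hi⟩, rfl⟩, rfl⟩
      exact ⟨⟨Fin.rev i, by rw [Fin.rev_rev]; exact hi⟩, (SbC_swap_spikeBasis K i).symm⟩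
    · rintro ⟨⟨j, hj⟩, rfl⟩
      exact ⟨spikeBasis K n (Fin.rev j), ⟨⟨Fin.rev j, hj⟩, rfl⟩, by rw [SbC_swap_spikeBasis, Fin.rev_rev]⟩
  rw [Submodule.map_span, hset]

/-- **THE KERNEL FLAG OF THE LOWER SHEAR: `n!·c ≠ 0 ⇒ ker (SbC(1 0 c 1) − 1)^k = span{E_j : j < k}`** — the osculating flag of the pure class `E_0` (K6 conjugated by the swap). -/
theorem ker_SbC_lower_shear_sub_one_pow_eq_span (hfac : (n.factorial : K) ≠ 0) {c : K} (hc : c ≠ 0) (k : ℕ) :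
    LinearMap.ker ((SbC K 1 0 c 1 (n := n) - 1) ^ k) = Submodule.span K (Set.range fun j : {j : Fin (n + 1) // (j : ℕ) < k} => spikeBasis K n j) := by
  rw [ker_pow_lower_shear_eq_map, ker_SbC_shear_sub_one_pow_eq_span_of_factorial K hfac hc k, map_swap_span_spikeBasis]
  have e : (fun j : Fin (n + 1) => n < ((Fin.rev j : Fin (n + 1)) : ℕ) + k) = fun j : Fin (n + 1) => (j : ℕ) < k := by
    funext j; rw [Fin.val_rev]; exact propext (by have := j.2; omega)
  exact congrArg (fun Q : Fin (n + 1) → Prop => Submodule.span K (Set.range fun j : {j : Fin (n + 1) // Q j} => spikeBasis K n j)) e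

/-- **THE IMAGE FLAG OF THE LOWER SHEAR: `n!·c ≠ 0 ⇒ range (SbC(1 0 c 1) − 1)^k = span{E_j : j + k ≤ n}`.** -/
theorem range_SbC_lower_shear_sub_one_pow_eq_span (hfac : (n.factorial : K) ≠ 0) {c : K} (hc : c ≠ 0) (k : ℕ) :
    LinearMap.range ((SbC K 1 0 c 1 (n := n) - 1) ^ k) = Submodule.span K (Set.range fun j : {j : Fin (n + 1) // (j : ℕ) + k ≤ n} => spikeBasis K n j) := by
  rw [range_pow_lower_shear_eq_map, range_SbC_shear_sub_one_pow_eq_span_of_factorial K hfac hc k, map_swap_span_spikeBasis]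
  have e : (fun j : Fin (n + 1) => k ≤ ((Fin.rev j : Fin (n + 1)) : ℕ)) = fun j : Fin (n + 1) => (j : ℕ) + k ≤ n := by
    funext j; rw [Fin.val_rev]; exact propext (by have := j.2; omega)
  exact congrArg (fun Q : Fin (n + 1) → Prop => Submodule.span K (Set.range fun j : {j : Fin (n + 1) // Q j} => spikeBasis K n j)) e

/-- characteristic `0`: `ker (SbC(1 0 c 1) − 1)^k = span{E_0, …, E_{k−1}}` for every `c ≠ 0`. -/
theorem ker_SbC_lower_shear_sub_one_pow_eq_span_charZero [CharZero K] {c : K} (hc : c ≠ 0) (k : ℕ) :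
    LinearMap.ker ((SbC K 1 0 c 1 (n := n) - 1) ^ k) = Submodule.span K (Set.range fun j : {j : Fin (n + 1) // (j : ℕ) < k} => spikeBasis K n j) :=
  ker_SbC_lower_shear_sub_one_pow_eq_span K (Nat.cast_ne_zero.mpr (Nat.factorial_ne_zero n)) hc k

/-- characteristic `0`: `range (SbC(1 0 c 1) − 1)^k = span{E_0, …, E_{n−k}}` for every `c ≠ 0`. -/
theorem range_SbC_lower_shear_sub_one_pow_eq_span_charZero [CharZero K] {c : K} (hc : c ≠ 0) (k : ℕ) :
    LinearMap.range ((SbC K 1 0 c 1 (n := n) - 1) ^ k) = Submodule.span K (Set.range fun j : {j : Fin (n + 1) // (j : ℕ) + k ≤ n} => spikeBasis K n j) :=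
  range_SbC_lower_shear_sub_one_pow_eq_span K (Nat.cast_ne_zero.mpr (Nat.factorial_ne_zero n)) hc k

/-- **in particular the fixed classes of the lower shear are the multiples of the pure class: `ker (SbC(1 0 c 1) − 1) = span{E_0}`** (`n!·c ≠ 0`). -/
theorem ker_SbC_lower_shear_sub_one_eq_span (hfac : (n.factorial : K) ≠ 0) {c : K} (hc : c ≠ 0) :
    LinearMap.ker (SbC K 1 0 c 1 (n := n) - 1) = Submodule.span K (Set.range fun j : {j : Fin (n + 1) // (j : ℕ) < 1} => spikeBasis K n j) := by
  rw [← pow_one (SbC K 1 0 c 1 (n := n) - 1)]; exact ker_SbC_lower_shear_sub_one_pow_eq_span K hfac hc 1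

end Summit.Ventures.HSemireg.Wedge.HankelFrameChange
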